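import Mathlib
import Summits.Ventures.HodgeRepro.Tier4.LitCharacterExtension
import Summits.Ventures.HodgeRepro.Tier4.Common.RowTorus
import Summits.Ventures.HodgeRepro.Tier4.Common.TorusInfCompact
import Summits.Ventures.HodgeRepro.Tier4.Line4.TorusProduct
import Summits.Ventures.HodgeRepro.Tier4.Line4.TorusCocompactAniso

/-!
# Tier4/Line4/CharacterExtend — characters of `A` trivial on a closed cocompact `Γ` with PRESCRIBED restriction to a
compact subgroup `K` meeting `Γ` trivially, FROM the typed print [DE14] Cor. 3.6.2 (C-L4-B-EXTEND, generic part)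

Blind re-derivation cell `pub-hodge-repro`, Tier 4 «prove the step» (README §9–§10), seat t4-x2 (reserve
wall-breaker, gen 6; offer S16574).  Tree path `lean/Summits/Ventures/HodgeRepro/Tier4/Line4/CharacterExtend.lean`.
Imports: Mathlib + `Tier4/LitCharacterExtension` (t4-lit-5, p722810: the surjectivity clause of Deitmar–Echterhoff
2014 Cor. 3.6.2 as a named Prop).  No definition, no instance, no printed theorem proved.

WHY.  The wall's half (B) asks continuous unitary characters of the adelic torus `T(𝔸)`, trivial on `T(k)`, with
PRESCRIBED archimedean components.  The recorded reading (S16525 (iii), lit-5 row I-t4-lit-5-69) is: `T(k)\T(𝔸)` is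
compact, the image of `T_∞` in it is a closed subgroup isomorphic to `T_∞`, and the restriction map on characters of an
LCA group is surjective (the print).  Here that reading is made a THEOREM modulo the print alone, for every Hausdorff
commutative topological group `A`, closed subgroup `Γ` with compact quotient and compact subgroup `K` with
`Γ ⊓ K = ⊥`:
* `compactSpace_quotient_of_cocompact` — `A ⧸ Γ` is compact once `A = Γ · C` with `C` compact (the tree's
  `IsCocompactRational` shape, TorusCocompactAniso p718934 on the line's planes);
* `exists_continuousMonoidHom_extend_of_print` — every continuous character `ψ` of `K` is the restriction of a
  continuous character `χ` of `A` trivial on `Γ`.  Proof: `mk|_K : K → A ⧸ Γ` is injective (`Γ ⊓ K = ⊥`), continuous,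
  onto the image subgroup `B`; `B` is compact, hence closed in the Hausdorff quotient (T3 from `IsClosed Γ`, Mathlib
  `QuotientGroup.instT3Space`; locally compact from compact + R₁); `K ≃ₜ B` (`Continuous.homeoOfEquivCompactToT2`);
  `ψ ∘ (K ≃ₜ B)⁻¹` is a continuous character of the closed subgroup `B`; the print extends it to `A ⧸ Γ`; compose with
  `mk`.  NOT needed on this route: the closedness of `Γ · K` in `A` (S16548 (2)) — the image of `K` is closed because it
  is compact.
INSTANCE (section `Torus`): `exists_torusT_character_extend_of_print` on any plane whose adelic torus commutes
(`hcomm`), with `T(k)` closed, `T_∞` compact, `T(𝔸) = T(k) · C` and `T(k) ∩ T_∞ = 1` as hypotheses, and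
`exists_torusT_ofLinesRow_character_extend_of_print` on a row plane `ofLinesRow q a b ε` (the line's shape) with the
commutativity (typer-2 RowTorus `torusT_ofLinesRow_comm`), the compactness of `T_∞` (typer-2 TorusInfCompact) and the
cocompactness (L4-p2 TorusCocompactAniso p718934, `hg`, `hA`) discharged by name, and
`exists_torusT_character_complex_of_print` = the `ℂ`-valued form (the wall's `chi`, `chi_mul`, `chi_rational`, `hc`,
`hu` shape, `Circle.coe` of the extension); the closedness of `T(k)` and
`T(k) ∩ T_∞ = 1` (L4-p2's TorusArchClosed, C-L4-B-ARCH-CLOSED) stay binders for the caller.  The `CommGroup` structure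
that the print's statement needs is a `letI` in the type of the `hDE` binder (the tree's `Group` instance plus
commutativity; NO instance is declared anywhere).
The identity of the face's character (which weights, which finite data, the centre condition N2) is the bridge's;
nothing here chooses it.  Nothing here says anything about the status of the Hodge conjecture for CM abelian
varieties, which is NOT proved; HC_CM is NOT proved by anyone in this repository.
-/

set_option autoImplicit false

noncomputable section

namespace Summit.Ventures.HodgeRepro.Tier4.Line4

open Summit.Ventures.HodgeRepro.Tier4.Lit

section Generic

variable {A : Type*} [CommGroup A] [TopologicalSpace A] [IsTopologicalGroup A]

omit [IsTopologicalGroup A] in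
/-- **Compactness of `A ⧸ Γ` from a compact set of representatives**: if `A = Γ · C` with `C` compact (the tree's
`IsCocompactRational` shape), the quotient space `A ⧸ Γ` is compact — it is the continuous image of `C`. -/
theorem compactSpace_quotient_of_cocompact (Γ : Subgroup A)
    (hcoc : ∃ C : Set A, IsCompact C ∧ ∀ x : A, ∃ γ : Γ, ∃ c ∈ C, x = (γ : A) * c) :
    CompactSpace (A ⧸ Γ) := by
  obtain ⟨C, hC, hcov⟩ := hcoc
  rw [← isCompact_univ_iff]
  have hu : (Set.univ : Set (A ⧸ Γ)) = (QuotientGroup.mk : A → A ⧸ Γ) '' C := by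
    ext x
    simp only [Set.mem_univ, true_iff]
    induction x using QuotientGroup.induction_on with
    | H a =>
      obtain ⟨γ, c, hc, rfl⟩ := hcov a
      refine ⟨c, hc, ?_⟩
      rw [QuotientGroup.eq]
      have : c⁻¹ * ((γ : A) * c) = (γ : A) := by rw [mul_comm (γ : A) c, inv_mul_cancel_left]
      rw [this]
      exact γ.2
  rw [hu]
  exact hC.image QuotientGroup.continuous_mk

omit [TopologicalSpace A] [IsTopologicalGroup A] in
/-- The restriction of the quotient map `A → A ⧸ Γ` to a subgroup `K` with `Γ ⊓ K = ⊥` is injective. -/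
theorem quotient_mk_injective_of_inf_eq_bot (Γ K : Subgroup A) (hbot : Γ ⊓ K = ⊥) :
    Function.Injective (fun t : K => (QuotientGroup.mk (t : A) : A ⧸ Γ)) := by
  intro t t' h
  have h' : (t : A)⁻¹ * (t' : A) ∈ Γ := QuotientGroup.eq.mp h
  have hmem : (t : A)⁻¹ * (t' : A) ∈ Γ ⊓ K := ⟨h', K.mul_mem (K.inv_mem t.2) t'.2⟩
  rw [hbot, Subgroup.mem_bot] at hmem
  exact Subtype.ext (inv_mul_eq_one.mp hmem)

/-- **Characters of `A` trivial on `Γ` with prescribed restriction to a compact `K`, from the print [DE14] Cor. 3.6.2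
on the compact quotient `A ⧸ Γ`.**  Hypotheses: `A` a Hausdorff commutative topological group, `Γ` a closed subgroup
with `A ⧸ Γ` compact (`compactSpace_quotient_of_cocompact`), `K` a compact subgroup with `Γ ⊓ K = ⊥`, and the print
`hDE` (the surjectivity of `χ ↦ χ|_B` for closed `B ≤ A ⧸ Γ`, typed by t4-lit-5 as
`DeitmarEchterhoff2014_Cor_3_6_2_restriction_surjective (A ⧸ Γ)`; the instances it needs — `T2Space` from
`IsClosed Γ`, `LocallyCompactSpace` from compactness — are Mathlib's).  Conclusion: every continuous character `ψ` of
`K` is the restriction of a continuous character `χ` of `A` with `χ|_Γ = 1`. -/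
theorem exists_continuousMonoidHom_extend_of_print (Γ K : Subgroup A)
    [IsClosed (Γ : Set A)] [CompactSpace (A ⧸ Γ)]
    (hK : IsCompact (K : Set A)) (hbot : Γ ⊓ K = ⊥)
    (hDE : DeitmarEchterhoff2014_Cor_3_6_2_restriction_surjective (A ⧸ Γ))
    (ψ : ContinuousMonoidHom K Circle) :
    ∃ χ : ContinuousMonoidHom A Circle, (∀ γ ∈ Γ, χ γ = 1) ∧ ∀ t : K, χ (t : A) = ψ t := by
  -- the restriction of the quotient map to `K`, as a monoid homomorphism onto its range `B`
  let f : K →* A ⧸ Γ := (QuotientGroup.mk' Γ).comp K.subtype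
  let B : Subgroup (A ⧸ Γ) := f.range
  have hf_inj : Function.Injective f := quotient_mk_injective_of_inf_eq_bot Γ K hbot
  have hf_cont : Continuous f := QuotientGroup.continuous_mk.comp continuous_subtype_val
  -- `B` is compact, hence closed in the Hausdorff quotient
  have hBc : IsCompact (B : Set (A ⧸ Γ)) := by
    have hB : (B : Set (A ⧸ Γ)) = (QuotientGroup.mk : A → A ⧸ Γ) '' (K : Set A) := by
      ext x
      constructor
      · rintro ⟨t, rfl⟩
        exact ⟨(t : A), t.2, rfl⟩
      · rintro ⟨a, ha, rfl⟩
        exact ⟨⟨a, ha⟩, rfl⟩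
    rw [hB]
    exact hK.image QuotientGroup.continuous_mk
  have hBcl : IsClosed (B : Set (A ⧸ Γ)) := hBc.isClosed
  -- `K ≃* B`, continuous, from a compact space to a Hausdorff one: a homeomorphism
  let e : K ≃* B := MulEquiv.ofBijective f.rangeRestrict
    ⟨fun t t' h => hf_inj (by simpa [MonoidHom.coe_rangeRestrict] using congrArg Subtype.val h),
      f.rangeRestrict_surjective⟩
  have he_cont : Continuous e := by
    apply Continuous.subtype_mk
    exact hf_cont
  haveI : CompactSpace K := isCompact_iff_compactSpace.mp hK
  let h : K ≃ₜ B := Continuous.homeoOfEquivCompactToT2 (f := e.toEquiv) he_cont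
  have hsymm_cont : Continuous (e.symm : B → K) := h.symm.continuous
  -- the prescribed character transported to `B`
  let ψ' : ContinuousMonoidHom B Circle :=
    ψ.comp { (e.symm : B →* K) with continuous_toFun := hsymm_cont }
  -- the print: extend `ψ'` from the closed subgroup `B` to `A ⧸ Γ`
  obtain ⟨χ'', hχ''⟩ := hDE B hBcl ψ'
  -- compose with the quotient map
  let π : ContinuousMonoidHom A (A ⧸ Γ) := { QuotientGroup.mk' Γ with continuous_toFun := QuotientGroup.continuous_mk }
  refine ⟨χ''.comp π, ?_, ?_⟩
  · intro γ hγ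
    have h1 : (QuotientGroup.mk γ : A ⧸ Γ) = 1 := (QuotientGroup.eq_one_iff γ).mpr hγ
    show χ'' (QuotientGroup.mk γ) = 1
    rw [h1, map_one]
  · intro t
    have h1 : (⟨f t, ⟨t, rfl⟩⟩ : B) = e t := rfl
    have h2 := hχ'' (e t)
    show χ'' (QuotientGroup.mk (t : A)) = ψ t
    have h3 : ((e t : B) : A ⧸ Γ) = QuotientGroup.mk (t : A) := rfl
    rw [← h3, h2]
    show ψ (e.symm (e t)) = ψ t
    rw [MulEquiv.symm_apply_apply]

end Generic

section Torus

open NumberField Summit.Ventures.HodgeRepro.Tier4.Common Summit.Ventures.HodgeRepro.Tier4.Line1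

variable {k : Type} [Field k] [NumberField k]

/-- **The existence half of (B) on ANY plane whose torus commutes, as a theorem modulo the print**: on a plane `W`
with `T(𝔸)` commutative (`hcomm`), `T(k)` closed (`[hcl]`, L4-p2's `isClosed_rationalOf_torusT`), `T_∞` compact
(`[CompactSpace (torusInf W)]`, typer-2's TorusInfCompact under `hcm`), `T(𝔸) = T(k) · C` with `C` compact (`hcoc`,
TorusCocompactAniso `cocompact_rationalOf_torusT_of_anisotropic`), `T(k) ∩ T_∞ = 1` (`hbot`, L4-p2's
`rationalOf_inf_torusInf_eq_bot`) and the print `hDE` for the compact quotient `T(k)\T(𝔸)`: every continuous character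
`ψ` of `T_∞` is the restriction of a continuous unitary character `χ : T(𝔸) → 𝕋` trivial on `T(k)`.  The commutative
group structure the print's statement needs on `T(𝔸)` is the `letI` in the type of `hDE` (the tree's `Group` instance
with `hcomm`; no instance is declared), and the compactness instance of the quotient is
`compactSpace_quotient_of_cocompact` — both spelled out in the binder so that the statement is self-contained. -/
theorem exists_torusT_character_extend_of_print (W : PlaneData k)
    (hcomm : ∀ g h : torusT W, g * h = h * g)
    [hcl : IsClosed ((rationalOf W (torusT W) : Subgroup (torusT W)) : Set (torusT W))]
    [CompactSpace (torusInf W)]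
    (hcoc : ∃ C : Set (torusT W), IsCompact C ∧ ∀ x : torusT W, ∃ γ : rationalOf W (torusT W), ∃ c ∈ C,
      x = (γ : torusT W) * c)
    (hbot : rationalOf W (torusT W) ⊓ torusInf W = ⊥)
    (hDE : letI : CommGroup (torusT W) := { (inferInstance : Group (torusT W)) with mul_comm := hcomm }
      haveI : CompactSpace (torusT W ⧸ rationalOf W (torusT W)) :=
        compactSpace_quotient_of_cocompact (rationalOf W (torusT W)) hcoc
      DeitmarEchterhoff2014_Cor_3_6_2_restriction_surjective (torusT W ⧸ rationalOf W (torusT W)))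
    (ψ : ContinuousMonoidHom (torusInf W) Circle) :
    ∃ χ : ContinuousMonoidHom (torusT W) Circle,
      (∀ γ ∈ rationalOf W (torusT W), χ γ = 1) ∧ ∀ t : torusInf W, χ (t : torusT W) = ψ t := by
  letI : CommGroup (torusT W) := { (inferInstance : Group (torusT W)) with mul_comm := hcomm }
  haveI : CompactSpace (torusT W ⧸ rationalOf W (torusT W)) :=
    compactSpace_quotient_of_cocompact (rationalOf W (torusT W)) hcoc
  exact exists_continuousMonoidHom_extend_of_print (rationalOf W (torusT W)) (torusInf W)
    (isCompact_iff_compactSpace.mpr ‹_›) hbot hDE ψ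

/-- **The wall's `ℂ`-valued character fields from the extension** (the shape of `RTFData.chi`, `chi_mul`,
`chi_rational`, and the wall's continuity / unitarity binders `hc`, `hu`): under the hypotheses of
`exists_torusT_character_extend_of_print`, a `ℂ`-valued function `chi` on `T(𝔸)`, multiplicative, trivial on `T(k)`,
continuous, of modulus one, restricting to the prescribed `ψ` on `T_∞` (`Circle.coe` of the extension). -/
theorem exists_torusT_character_complex_of_print (W : PlaneData k)
    (hcomm : ∀ g h : torusT W, g * h = h * g)
    [hcl : IsClosed ((rationalOf W (torusT W) : Subgroup (torusT W)) : Set (torusT W))]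
    [CompactSpace (torusInf W)]
    (hcoc : ∃ C : Set (torusT W), IsCompact C ∧ ∀ x : torusT W, ∃ γ : rationalOf W (torusT W), ∃ c ∈ C,
      x = (γ : torusT W) * c)
    (hbot : rationalOf W (torusT W) ⊓ torusInf W = ⊥)
    (hDE : letI : CommGroup (torusT W) := { (inferInstance : Group (torusT W)) with mul_comm := hcomm }
      haveI : CompactSpace (torusT W ⧸ rationalOf W (torusT W)) :=
        compactSpace_quotient_of_cocompact (rationalOf W (torusT W)) hcoc
      DeitmarEchterhoff2014_Cor_3_6_2_restriction_surjective (torusT W ⧸ rationalOf W (torusT W)))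
    (ψ : ContinuousMonoidHom (torusInf W) Circle) :
    ∃ chi : torusT W → ℂ, (∀ s t : torusT W, chi (s * t) = chi s * chi t) ∧
      (∀ t ∈ rationalOf W (torusT W), chi t = 1) ∧ Continuous chi ∧ (∀ t, ‖chi t‖ = 1) ∧
        ∀ t : torusInf W, chi (t : torusT W) = ((ψ t : Circle) : ℂ) := by
  obtain ⟨χ, hΓ, hK⟩ := exists_torusT_character_extend_of_print W hcomm hcoc hbot hDE ψ
  refine ⟨fun t => ((χ t : Circle) : ℂ), fun s t => ?_, fun t ht => ?_, ?_, fun t => Circle.norm_coe _, fun t => ?_⟩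
  · show ((χ (s * t) : Circle) : ℂ) = ((χ s : Circle) : ℂ) * ((χ t : Circle) : ℂ)
    rw [map_mul, Circle.coe_mul]
  · show ((χ t : Circle) : ℂ) = 1
    rw [hΓ t ht, Circle.coe_one]
  · exact continuous_subtype_val.comp χ.continuous
  · show ((χ (t : torusT W) : Circle) : ℂ) = ((ψ t : Circle) : ℂ)
    rw [hK t]

/-- **The same on a ROW PLANE `ofLinesRow q a b ε`** (the shape of the line's planes), with the commutativity of the
torus (typer-2 `torusT_ofLinesRow_comm`), the compactness of `T_∞` (typer-2
`compactSpace_infinitePart_subgroupOf_torusT_ofLinesRow`, under `hreal`, `hcm`) and the cocompactness of `T(k)`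
(L4-p2 `cocompact_rationalOf_torusT_of_anisotropic`, under `hg`, `hA`) discharged BY NAME; `[hcl]` and `hbot` stay
binders (L4-p2's TorusArchClosed, consumed by name by the caller). -/
theorem exists_torusT_ofLinesRow_character_extend_of_print (q : QuadData k) (a b ε : k)
    (ha : a ≠ 0) (hb : b ≠ 0) (hε : ε ≠ 0)
    (hreal : ∀ w : InfinitePlace k, w.IsReal) (hcm : ∀ w, IsCMAt q w)
    (hg : IsGenuineRow (PlaneData.ofLinesRow q a b ε)) (hA : IsAnisotropic (PlaneData.ofLinesRow q a b ε))
    [hcl : IsClosed ((rationalOf (PlaneData.ofLinesRow q a b ε) (torusT (PlaneData.ofLinesRow q a b ε)) :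
      Subgroup (torusT (PlaneData.ofLinesRow q a b ε))) : Set (torusT (PlaneData.ofLinesRow q a b ε)))]
    (hbot : rationalOf (PlaneData.ofLinesRow q a b ε) (torusT (PlaneData.ofLinesRow q a b ε)) ⊓
      torusInf (PlaneData.ofLinesRow q a b ε) = ⊥)
    (hDE : letI : CommGroup (torusT (PlaneData.ofLinesRow q a b ε)) :=
        { (inferInstance : Group (torusT (PlaneData.ofLinesRow q a b ε))) with
          mul_comm := fun g h => Subtype.ext (torusT_ofLinesRow_comm q a b ε ha hb hε g h g.2 h.2) }
      haveI : CompactSpace (torusT (PlaneData.ofLinesRow q a b ε) ⧸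
          rationalOf (PlaneData.ofLinesRow q a b ε) (torusT (PlaneData.ofLinesRow q a b ε))) :=
        compactSpace_quotient_of_cocompact _ (cocompact_rationalOf_torusT_of_anisotropic _ hg hA)
      DeitmarEchterhoff2014_Cor_3_6_2_restriction_surjective (torusT (PlaneData.ofLinesRow q a b ε) ⧸
        rationalOf (PlaneData.ofLinesRow q a b ε) (torusT (PlaneData.ofLinesRow q a b ε))))
    (ψ : ContinuousMonoidHom (torusInf (PlaneData.ofLinesRow q a b ε)) Circle) :
    ∃ χ : ContinuousMonoidHom (torusT (PlaneData.ofLinesRow q a b ε)) Circle,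
      (∀ γ ∈ rationalOf (PlaneData.ofLinesRow q a b ε) (torusT (PlaneData.ofLinesRow q a b ε)), χ γ = 1) ∧
        ∀ t : torusInf (PlaneData.ofLinesRow q a b ε), χ (t : torusT (PlaneData.ofLinesRow q a b ε)) = ψ t := by
  haveI : CompactSpace (torusInf (PlaneData.ofLinesRow q a b ε)) :=
    compactSpace_infinitePart_subgroupOf_torusT_ofLinesRow q a b ε ha hb hε hreal hcm
  exact exists_torusT_character_extend_of_print (PlaneData.ofLinesRow q a b ε)
    (fun g h => Subtype.ext (torusT_ofLinesRow_comm q a b ε ha hb hε g h g.2 h.2))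
    (cocompact_rationalOf_torusT_of_anisotropic _ hg hA) hbot hDE ψ

end Torus

end Summit.Ventures.HodgeRepro.Tier4.Line4

end
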